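import Mathlib
import HarnessLib
import Literature.Analysis.FluidPDE.Tao2016AveragedNS.LocalCascadeSolutions
import Literature.Analysis.FluidPDE.Tao2016AveragedNS.RenormalisedCascadeWaves
import Literature.Analysis.FluidPDE.Tao2016AveragedNS.ViscousEternalSolutions
import Literature.Analysis.FluidPDE.Tao2016AveragedNS.BoundedEternalSolutions
import Summits.NavierStokesRegularity.NavierStokesRegularity.Theorems.TaoLadderRungTwoBreakNoSurvivingEternalViscBddOneSurvivalLoud

/-!
# Crux K1ᵛ(1) `TaoLadderRungTwoBreak.NoSurvivingEternalViscBddOne` (stmt-NavierStokesRegularity-20419), child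
# (ρ+) `NoLoudLadderOne`: for `ν̂ > 0`, (S₁)-SURVIVAL IS LOUD ON EVERY SHELL — on EVERY cancelling table, at a
# level independent of the action; ONE amplitude-quiet shell excludes (S₁)-survival (a new unconditional slice)

MODEL lattice ODEs only (Tao 2016 §4 in the self-similar log-time variables of §6.4); nothing in this file
is a statement about the Navier–Stokes equations, and no summit or rung LEAF is proved by it
(`--supports stmt-NavierStokesRegularity-20419 --as helper`).  `C_A = fluxConst α`, `Λ = bigLam ε₀`,
`q₀ = 1/(4Λ(C_A+1))`.

`…SurvivalLoud` needed sign-coherent bonds.  For `ν̂ > 0` no sign hypothesis is needed, by a DICHOTOMY: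
either arbitrarily high shells get loud at level `q₀` — then the unconditional loud down-set
(`…TailBarrier.loud_downset_visc`) lights every shell — or some tail `j ≥ k` NEVER exceeds `q₀`; on such a
tail every bond has the backscatter margin forever, the whole-line action fence (`action_le_margin_real`)
gives `a_j ≤ (4/3)ΛC_A q₀ · a_{j-1} ≤ a_{j-1}/3`, the actions decay geometrically, and the tree's TAIL CONVEYOR
(`frequently_largeAction_of_survivingFwd`: survival needs infinitely many bonds with `(1+ε₀)2C_AΛ⁻¹a > 1/2`)
is contradicted.

* `action_le_margin_real` — whole-line action fence under the margin `4 C_A ‖W_{k+1}‖ ≤ Λ` (any `ν̂ ≥ 0`).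
* `actions_decay_on_neverLoud_tail` — on a tail that never exceeds `q₀`, `∫‖W_{k+1+i}‖ ≤ 3^{-i} ∫‖W_{k+1}‖`.
* `not_survivingFwd_of_neverLoud_tail` — hence a tail that never exceeds `q₀` excludes (S₁)-survival (any `ν̂ ≥ 0`,
  any cancelling table, uniformly bounded solution).
* `survivingFwd_loud_everywhere_visc` — **`ν̂ > 0`: (S₁)-survival ⇒ EVERY shell exceeds `q₀` at some log-time**,
  on every cancelling table, whatever the action.
* `not_survivingFwd_of_amplitudeQuietShell_visc`, `noSurvivingEternalViscBdd_rung_amplitudeQuietShell` — the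
  contrapositive as an UNCONDITIONAL SLICE of the crux predicate in binder shape: below any threshold, no table of
  `InTableClass R` carries a uniformly bounded admissible eternal solution with `ν̂ > 0`, ONE shell of renormalised
  amplitude `≤ q₀` at all log-times, and forward (S₁)-survival.  (The tree's `SurvivingIffLoud.not_survivingFwd_of_quietShell`
  is the weighted-ENERGY quiet-shell slice `p_n < ν̂²/4096`; this is the AMPLITUDE quiet-shell slice — neither implies the other.)

HONEST LABEL: (ρ+) = «no bounded viscous eternal solution is wt-loud on every shell» stays OPEN; what is proved is
that a surviving one is amplitude-loud on every shell; ⟨20419⟩ OPEN; rung 0.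
-/

noncomputable section

-- the summit and its single sub-problem share the name (CONVENTIONS §1)
set_option linter.dupNamespace false

namespace Summit.NavierStokesRegularity.NavierStokesRegularity.Theorems.NoSurvivingEternalViscBddOne.TailBarrier

open Set Filter Topology MeasureTheory intervalIntegral
open scoped RealInnerProductSpace
open Literature.Analysis.FluidPDE Literature.Analysis.FluidPDE.TaoCascade
open Summit.NavierStokesRegularity.NavierStokesRegularity.Theorems.NoSurvivingEternalViscBddOne.TailConveyor
  (frequently_largeAction_of_survivingFwd)

variable {m : ℕ} {ε₀ νh : ℝ} {α : Fin m → Fin m → Fin m → ℤ × ℤ × ℤ → ℝ} {W : ℤ → ℝ → Em m}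

/-! ## Whole-line action fence under the margin -/

/-- **Whole-line action fence, margin form** (any `ν̂ ≥ 0`): if the shell above obeys `4 C_A ‖W_{k+1}‖ ≤ Λ` at all
log-times, `‖W_{k-1}‖ ≤ M` at all log-times and `‖W_k(s)‖ → 0` as `s → -∞`, then
`(3/4) ∫_ℝ ‖W_k‖ ≤ Λ C_A · M · ∫_ℝ ‖W_{k-1}‖`.
[cite: Tao2016AveragedNS, §4 (4.1), (4.3), Lemma 4.1 (4.8); §6.4] -/
theorem action_le_margin_real (hε : 0 < ε₀) (hW : IsEternalVisc ε₀ νh α W) (hc : IsCancellingCoeff α)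
    {k : ℤ} {M : ℝ} (hM : ∀ s, ‖W (k - 1) s‖ ≤ M)
    (hmar : ∀ s, 4 * fluxConst α * ‖W (k + 1) s‖ ≤ bigLam ε₀)
    (hdec : Tendsto (fun s => ‖W k s‖) atBot (𝓝 0)) :
    (3 / 4) * ∫ s, ‖W k s‖ ≤ bigLam ε₀ * fluxConst α * M * ∫ s, ‖W (k - 1) s‖ := by
  have hΛ : 0 < bigLam ε₀ := bigLam_pos (by linarith)
  have hCA : 0 ≤ fluxConst α := fluxConst_nonneg α
  have hM0 : 0 ≤ M := (norm_nonneg _).trans (hM 0)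
  obtain ⟨Mact, hact⟩ := hW.action
  have hintk : Integrable (fun s => ‖W k s‖) := (hact k).1
  have hintk1 : Integrable (fun s => ‖W (k - 1) s‖) := (hact (k - 1)).1
  have hcont : Continuous (W (k - 1)) :=
    continuous_iff_continuousAt.2 fun x => (hW.law (k - 1) x).continuousAt
  have hwin : ∀ j : ℕ, (3 / 4) * ∫ s in (-(j : ℝ))..(j : ℝ), ‖W k s‖
      ≤ ‖W k (-(j : ℝ))‖ + bigLam ε₀ * fluxConst α * M * ∫ s, ‖W (k - 1) s‖ := by
    intro j
    have hj : (-(j : ℝ)) ≤ (j : ℝ) := by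
      have : (0 : ℝ) ≤ j := Nat.cast_nonneg j
      linarith
    have h1 := action_le_slaved hε hW hc hj (fun s _ _ => hmar s)
    have h2 : ∫ s in (-(j : ℝ))..(j : ℝ), ‖W (k - 1) s‖ ^ 2 ≤ ∫ s in (-(j : ℝ))..(j : ℝ), M * ‖W (k - 1) s‖ := by
      refine intervalIntegral.integral_mono_on hj ((hcont.norm.pow 2).intervalIntegrable _ _)
        ((continuous_const.mul hcont.norm).intervalIntegrable _ _) fun x _ => ?_
      calc ‖W (k - 1) x‖ ^ 2 = ‖W (k - 1) x‖ * ‖W (k - 1) x‖ := sq _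
        _ ≤ M * ‖W (k - 1) x‖ := mul_le_mul_of_nonneg_right (hM x) (norm_nonneg _)
    rw [intervalIntegral.integral_const_mul] at h2
    have h3 : ∫ s in (-(j : ℝ))..(j : ℝ), ‖W (k - 1) s‖ ≤ ∫ s, ‖W (k - 1) s‖ := by
      rw [intervalIntegral.integral_of_le hj]
      exact setIntegral_le_integral hintk1 (Eventually.of_forall fun s => norm_nonneg _)
    have h4 : bigLam ε₀ * fluxConst α * ∫ s in (-(j : ℝ))..(j : ℝ), ‖W (k - 1) s‖ ^ 2
        ≤ bigLam ε₀ * fluxConst α * (M * ∫ s, ‖W (k - 1) s‖) := by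
      refine mul_le_mul_of_nonneg_left (h2.trans ?_) (by positivity)
      exact mul_le_mul_of_nonneg_left h3 hM0
    linarith
  have hlim1 : Tendsto (fun j : ℕ => (3 / 4) * ∫ s in (-(j : ℝ))..(j : ℝ), ‖W k s‖) atTop
      (𝓝 ((3 / 4) * ∫ s, ‖W k s‖)) := by
    refine Tendsto.const_mul _ ?_
    exact intervalIntegral_tendsto_integral hintk
      (tendsto_neg_atTop_atBot.comp tendsto_natCast_atTop_atTop) tendsto_natCast_atTop_atTop
  have hlim2 : Tendsto (fun j : ℕ => ‖W k (-(j : ℝ))‖ + bigLam ε₀ * fluxConst α * M * ∫ s, ‖W (k - 1) s‖)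
      atTop (𝓝 (0 + bigLam ε₀ * fluxConst α * M * ∫ s, ‖W (k - 1) s‖)) := by
    refine Tendsto.add_const _ ?_
    exact hdec.comp (tendsto_neg_atTop_atBot.comp tendsto_natCast_atTop_atTop)
  rw [zero_add] at hlim2
  exact le_of_tendsto_of_tendsto' hlim1 hlim2 hwin

/-! ## A never-loud tail has geometrically decaying actions and excludes survival -/

/-- **Actions decay geometrically on a tail that never gets loud** (any `ν̂ ≥ 0`): if every shell `j ≥ k` of a
uniformly bounded admissible eternal solution of a cancelling table satisfies `‖W_j(s)‖ ≤ q₀ = 1/(4Λ(C_A+1))` at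
ALL log-times, then `∫‖W_{k+1+i}‖ ≤ 3^{-i} ∫‖W_{k+1}‖` for every `i`.
[cite: Tao2016AveragedNS, §4 (4.1), (4.3), Lemma 4.1 (4.8)–(4.10); §6.4] -/
theorem actions_decay_on_neverLoud_tail (hε : 0 < ε₀) (hW : IsEternalVisc ε₀ νh α W)
    (hc : IsCancellingCoeff α) {B : ℝ} (hB : ∀ (k : ℤ) (σ : ℝ), ‖W k σ‖ ≤ B) {k : ℤ}
    (hquiet : ∀ j : ℤ, k ≤ j → ∀ s, ‖W j s‖ ≤ 1 / (4 * bigLam ε₀ * (fluxConst α + 1))) :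
    ∀ i : ℕ, ∫ s, ‖W (k + 1 + i) s‖ ≤ (1 / 3) ^ i * ∫ s, ‖W (k + 1) s‖ := by
  have hΛ1 : 1 ≤ bigLam ε₀ := one_le_bigLam hε.le
  have hΛ : 0 < bigLam ε₀ := by linarith
  have hCA : 0 ≤ fluxConst α := fluxConst_nonneg α
  set q : ℝ := 1 / (4 * bigLam ε₀ * (fluxConst α + 1)) with hq
  have hq0 : 0 < q := by rw [hq]; positivity
  have hqd : q * (4 * bigLam ε₀ * (fluxConst α + 1)) = 1 := by rw [hq]; field_simp
  -- the margin holds everywhere on the tail, and (4/3) Λ C_A q ≤ 1/3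
  have hq4 : 4 * fluxConst α * q ≤ bigLam ε₀ := by
    have h1 : 4 * fluxConst α * q ≤ 4 * (fluxConst α + 1) * bigLam ε₀ * q := by
      have : fluxConst α ≤ (fluxConst α + 1) * bigLam ε₀ := by nlinarith
      nlinarith
    have h2 : 4 * (fluxConst α + 1) * bigLam ε₀ * q = 1 := by linarith [hqd]
    linarith
  have hrate : bigLam ε₀ * fluxConst α * q ≤ 1 / 4 := by
    have h1 : bigLam ε₀ * fluxConst α * q ≤ bigLam ε₀ * (fluxConst α + 1) * q := by nlinarith
    have h2 : bigLam ε₀ * (fluxConst α + 1) * q = 1 / 4 := by linarith [hqd]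
    linarith
  intro i
  induction i with
  | zero => simp
  | succ i ih =>
    have hk : k + 1 + ((i + 1 : ℕ) : ℤ) - 1 = k + 1 + (i : ℕ) := by push_cast; ring
    have hk' : k + 1 + ((i + 1 : ℕ) : ℤ) + 1 = k + 1 + (i : ℕ) + 2 := by push_cast; ring
    have hM : ∀ s, ‖W (k + 1 + ((i + 1 : ℕ) : ℤ) - 1) s‖ ≤ q := by
      intro s; rw [hk]; exact hquiet _ (by omega) s
    have hmar : ∀ s, 4 * fluxConst α * ‖W (k + 1 + ((i + 1 : ℕ) : ℤ) + 1) s‖ ≤ bigLam ε₀ := by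
      intro s
      calc 4 * fluxConst α * ‖W (k + 1 + ((i + 1 : ℕ) : ℤ) + 1) s‖ ≤ 4 * fluxConst α * q :=
            mul_le_mul_of_nonneg_left (hquiet _ (by omega) s) (by positivity)
        _ ≤ bigLam ε₀ := hq4
    have hdec := tendsto_norm_atBot_of_uniformBound hε hW hc hB (k + 1 + ((i + 1 : ℕ) : ℤ))
    have h := action_le_margin_real hε hW hc hM hmar hdec
    rw [hk] at h
    have hI0 : 0 ≤ ∫ s, ‖W (k + 1 + (i : ℕ)) s‖ := integral_nonneg fun s => norm_nonneg _
    have h2 : ∫ s, ‖W (k + 1 + ((i + 1 : ℕ) : ℤ)) s‖ ≤ (1 / 3) * ∫ s, ‖W (k + 1 + (i : ℕ)) s‖ := by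
      have : bigLam ε₀ * fluxConst α * q * ∫ s, ‖W (k + 1 + (i : ℕ)) s‖
          ≤ (1 / 4) * ∫ s, ‖W (k + 1 + (i : ℕ)) s‖ := mul_le_mul_of_nonneg_right hrate hI0
      linarith
    calc ∫ s, ‖W (k + 1 + ((i + 1 : ℕ) : ℤ)) s‖ ≤ (1 / 3) * ∫ s, ‖W (k + 1 + (i : ℕ)) s‖ := h2
      _ ≤ (1 / 3) * ((1 / 3) ^ i * ∫ s, ‖W (k + 1) s‖) := mul_le_mul_of_nonneg_left ih (by norm_num)
      _ = (1 / 3) ^ (i + 1) * ∫ s, ‖W (k + 1) s‖ := by rw [pow_succ]; ring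

/-- **A tail that never gets loud excludes (S₁)-survival** (any `ν̂ ≥ 0`, any cancelling table): if every shell
`j ≥ k` of a uniformly bounded admissible eternal solution stays at amplitude `≤ q₀ = 1/(4Λ(C_A+1))` at all
log-times, the solution is not forward (S₁)-surviving (geometrically decaying actions against the tail conveyor).
[cite: Tao2016AveragedNS, §4 (4.1), (4.3), Lemma 4.1 (4.8)–(4.10), the viscous equation before Thm. 4.2; §6.4] -/
theorem not_survivingFwd_of_neverLoud_tail (hε : 0 < ε₀) (hW : IsEternalVisc ε₀ νh α W)
    (hc : IsCancellingCoeff α) (hU : UniformBound W) {k : ℤ}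
    (hquiet : ∀ j : ℤ, k ≤ j → ∀ s, ‖W j s‖ ≤ 1 / (4 * bigLam ε₀ * (fluxConst α + 1))) :
    ¬ EternalSurvivingFwd 1 ε₀ W := by
  intro hS
  have hΛ : 0 < bigLam ε₀ := bigLam_pos (by linarith)
  have hCA : 0 ≤ fluxConst α := fluxConst_nonneg α
  obtain ⟨B, hB⟩ := hU
  have hdecay := actions_decay_on_neverLoud_tail hε hW hc hB hquiet
  have hfreq := frequently_largeAction_of_survivingFwd hε hW hc ⟨B, hB⟩ hS (by norm_num : (1 / 2 : ℝ) < 1)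
  -- the actions along the tail tend to 0, so the conveyor's frequent expensive bonds are impossible
  set A : ℝ := ∫ s, ‖W (k + 1) s‖ with hA
  have hA0 : 0 ≤ A := integral_nonneg fun s => norm_nonneg _
  set κ : ℝ := (1 + ε₀) * (2 * fluxConst α * (bigLam ε₀)⁻¹) with hκ
  have hκ0 : 0 ≤ κ := by positivity
  have hgeo : Tendsto (fun i : ℕ => κ * ((1 / 3 : ℝ) ^ i * A)) atTop (𝓝 (κ * (0 * A))) :=
    ((tendsto_pow_atTop_nhds_zero_of_lt_one (by norm_num) (by norm_num)).mul_const A).const_mul κ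
  rw [zero_mul, mul_zero] at hgeo
  obtain ⟨I, hI⟩ := eventually_atTop.1 (hgeo.eventually (gt_mem_nhds (by norm_num : (0 : ℝ) < 1 / 2)))
  -- an expensive bond beyond shell k + 1 + I
  obtain ⟨n, hn, hbig⟩ := frequently_atTop.1 hfreq ((k + 1 + I).toNat)
  have hnk : k + 1 ≤ (n : ℤ) + 1 := by omega
  obtain ⟨i, hi⟩ : ∃ i : ℕ, (n : ℤ) + 1 = k + 1 + i := ⟨((n : ℤ) + 1 - (k + 1)).toNat, by omega⟩
  have hiI : I ≤ i := by omega
  have h1 : ∫ s, ‖W ((n : ℤ) + 1) s‖ ≤ (1 / 3) ^ i * A := by rw [hi]; exact hdecay i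
  have h2 : (1 + ε₀) * (2 * fluxConst α * (bigLam ε₀)⁻¹ * ∫ s, ‖W ((n : ℤ) + 1) s‖)
      ≤ κ * ((1 / 3) ^ i * A) := by
    rw [hκ]
    have := mul_le_mul_of_nonneg_left h1 hκ0
    calc (1 + ε₀) * (2 * fluxConst α * (bigLam ε₀)⁻¹ * ∫ s, ‖W ((n : ℤ) + 1) s‖)
        = (1 + ε₀) * (2 * fluxConst α * (bigLam ε₀)⁻¹) * ∫ s, ‖W ((n : ℤ) + 1) s‖ := by ring
      _ ≤ (1 + ε₀) * (2 * fluxConst α * (bigLam ε₀)⁻¹) * ((1 / 3) ^ i * A) := this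
  have h3 := hI i hiI
  linarith

/-! ## `ν̂ > 0`: survival is loud on every shell, on every table -/

/-- **`ν̂ > 0`: (S₁)-SURVIVAL IS LOUD ON EVERY SHELL, on every cancelling table.**  A uniformly bounded admissible
viscous (`ν̂ > 0`) eternal solution that is forward (S₁)-surviving exceeds the amplitude `q₀ = 1/(4Λ(C_A+1))` on
EVERY shell at some log-time (dichotomy: loud shells arbitrarily high + the loud down-set, or a never-loud tail,
excluded by `not_survivingFwd_of_neverLoud_tail`).
[cite: Tao2016AveragedNS, §4 Thm. 4.2 (statement shape), Lemma 4.1 (4.8)–(4.10), the viscous equation before Thm. 4.2; §6.4] -/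
theorem survivingFwd_loud_everywhere_visc (hε : 0 < ε₀) (hν : 0 < νh) (hW : IsEternalVisc ε₀ νh α W)
    (hc : IsCancellingCoeff α) (hU : UniformBound W) (hS : EternalSurvivingFwd 1 ε₀ W) :
    ∀ j : ℤ, ∃ s : ℝ, 1 / (4 * bigLam ε₀ * (fluxConst α + 1)) < ‖W j s‖ := by
  intro j
  by_contra hnone
  push Not at hnone
  -- if shell j is never loud, is some higher shell loud? then j was loud (down-set) — contradiction;
  -- otherwise the tail above j is never loud — contradiction with survival.
  by_cases hhigh : ∃ k : ℤ, j ≤ k ∧ ∃ s, 1 / (4 * bigLam ε₀ * (fluxConst α + 1)) < ‖W k s‖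
  · obtain ⟨k, hjk, s, hs⟩ := hhigh
    obtain ⟨s', -, hs'⟩ := loud_downset_visc hε hν hW hc hU (σ₁ := s) le_rfl hs j hjk
    exact absurd (hnone s') (not_le.2 hs')
  · push Not at hhigh
    exact not_survivingFwd_of_neverLoud_tail hε hW hc hU (k := j) (fun k hk s => hhigh k hk s) hS

/-- **`ν̂ > 0`: ONE amplitude-quiet shell excludes (S₁)-survival** (every cancelling table): a uniformly bounded
admissible viscous eternal solution with a shell that stays at amplitude `≤ q₀ = 1/(4Λ(C_A+1))` at all log-times
is not forward (S₁)-surviving.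
[cite: Tao2016AveragedNS, §4 Thm. 4.2 (statement shape), the viscous equation before Thm. 4.2; §6.4] -/
theorem not_survivingFwd_of_amplitudeQuietShell_visc (hε : 0 < ε₀) (hν : 0 < νh)
    (hW : IsEternalVisc ε₀ νh α W) (hc : IsCancellingCoeff α) (hU : UniformBound W) {j : ℤ}
    (hquiet : ∀ s, ‖W j s‖ ≤ 1 / (4 * bigLam ε₀ * (fluxConst α + 1))) :
    ¬ EternalSurvivingFwd 1 ε₀ W := by
  intro hS
  obtain ⟨s, hs⟩ := survivingFwd_loud_everywhere_visc hε hν hW hc hU hS j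
  exact absurd (hquiet s) (not_le.2 hs)

/-- **THE AMPLITUDE QUIET-SHELL SLICE of `NoSurvivingEternalViscBdd R 1` (ν̂ > 0), in binder shape**: for every
spread `R` and EVERY `ε₀ > 0` (no threshold needed), no table of `InTableClass R` carries a uniformly bounded
admissible eternal solution with covariant viscosity `ν̂ > 0` having ONE shell of renormalised amplitude
`≤ 1/(4Λ(C_A+1))` at all log-times that is forward (S₁)-surviving.
[cite: Tao2016AveragedNS, §4 Thm. 4.2 (statement shape), §6.4; cell predicate `NoSurvivingEternalViscBdd`] -/
theorem noSurvivingEternalViscBdd_rung_amplitudeQuietShell (R : ℝ) :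
    ∀ ε₀ : ℝ, 0 < ε₀ →
      ∀ α : Fin 4 → Fin 4 → Fin 4 → ℤ × ℤ × ℤ → ℝ, InTableClass R α →
        ∀ (νh : ℝ) (W : ℤ → ℝ → Em 4), 0 < νh → IsEternalVisc ε₀ νh α W → UniformBound W →
          (∃ j : ℤ, ∀ s, ‖W j s‖ ≤ 1 / (4 * bigLam ε₀ * (fluxConst α + 1))) →
            ¬ EternalSurvivingFwd 1 ε₀ W := by
  intro ε₀ hε α hα νh W hν hW hU hq
  obtain ⟨j, hj⟩ := hq
  exact not_survivingFwd_of_amplitudeQuietShell_visc hε hν hW hα.2.1 hU hj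

end Summit.NavierStokesRegularity.NavierStokesRegularity.Theorems.NoSurvivingEternalViscBddOne.TailBarrier

end
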